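import Summits.QuantumFields.BalabanUV.Beta.GAN24.ExitChargeParityTower

/-!
# `BalabanUV.Beta.GAN24.RotatedVertexSlotInversionAllLevels` — binder row G-an2-4 ∕ (CONV-C), the (S) row of RULING R-gan24p1-g27-1 PART B (viii) ∕ R-gan24p1-g28-1 (i):
# **(INV-X-geo) AT EVERY LEVEL `k ≥ 0` — INCLUDING THE LEVEL-0 MEMBER OF THE σ-PAIR** (the first-order data `½ • (dM (conjV G₀ X_y) Lc S₀ M₀ − cH₀ • gauge-read₀)` that the
# BASE of road-P2's residual tower `WardResidualSRecursionAll.exists_kernelLaws_vertexForm` carries, `G₀ = coDressKBmAt ρ Lc (KInvStep Lc 0)`, `S₀ = SpureRecAt … 0`,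
# `M₀ = M1At … 0`), for the exit⊗exit class at the centred root, `Lc` odd, NO displayed hypothesis
# (G-an2-4 formalisation swarm → CRUX TEAM (2), seat `b2b-balaban-gan24-formalise-leaf-02`, gen 59; sequel of gen 58's `ExitChargeParityTower`)

NOT IN PRINT; OUR BOOKKEEPING ([folklore] `tsum` re-indexing by lattice involutions + instantiation BY NAME; 0 `def`, 0 cited fact, 0 `def … : Prop`, 0 sorry).
HONEST FRAMING (cell contract, verbatim): «discharging `BetaPertH` makes Bałaban's UV stability UNCONDITIONAL — a real constructive-QFT result; it is NOT the continuum
limit and NOT the Clay problem.»  HONEST DEPENDENCY (verbatim): «continuum YM on T⁴ ⇐ BetaPertH ∧ nine spine estimates (0/9 proved); BetaPertH ⇐ (D1) ∧ (D4) ∧ CAP+tail;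
G-an2-4 gates asym, D1 and NE2/3/4.»

WHY THIS FILE EXISTS.  Road-P2's (S)-row scaffolding — g38 `WardResidualRotatedVertexWeighted.hasSum_weighted_rotatedVertex_comb`, g39
`WardResidualRotatedVertexInversion.weightedProfile_comb_slotInv ∕ hasSum_weighted_rotatedVertexEnd_comb ∕ weightedCharge_rotatedVertex_slotInv` — and hence gen 58's
hypothesis-free (INV-X-geo) `ExitChargeParityTower.tsum_weightedCharge_rotatedVertex_slotInv_ctr_exit` carry the level token `j + 1` (the successor step of the residual
tower), although none of their proofs uses it: every input (`decays_coDressKBmAt_KInvStep`, `locStencil_SpureRecAt`, `vertexFamily_M1At`, gen 58's (INV-G)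
`colH_pointInv_ctr ∕ colM_pointInv_ctr`, `hZM` `tsum_spanExitWt_M1At_slotInv_ctr` and the parity tower's `exitCharge_spureRecAt_pointInv_exit`) is stated for EVERY level.
The (W-γ) half of the (S) row is typed at level 0 (leaf-06 g47 FILE F `GaugeReadExitWard.gaugeCharge_exit_eq_two_mul_cE_mul_rotatedVertexEnd`, objects `G₀, S₀, M₀`), so the
level at which the (S) row can be CLOSED today is exactly the one the `j + 1` token misses.  This file re-issues the four statements at a generic level `k` — SAME PROOFS,
token `j + 1 ↦ k`, road-P2's §1 re-indexing lemma `profile_slotInv_generic`-style argument and an2's `hasSum_weighted_dM` BY NAME; road-P2's `k = j + 1` members remain the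
canonical ones and are NOT touched — and then discharges (INV-G), `hZM`, `hZS` at every level `k` for the class `(p₁𝟙^{exit}_{κ₀}) ⊗ (p₂𝟙^{exit}_{κ₀′})` at the centred root.
* §1 `hasSum_weighted_rotatedVertex_comb_level` ∕ `hasSum_weighted_rotatedVertexEnd_comb_level` — the ω-charges of `(α)_y = ½ • dM (conjV G_k X_y) Lc S_k M_k` and of the
  END-POINT rotated vertex `(α⁺)_y` per slot, as the BASE-POINT ∕ END-POINT profiles (any in-block root, any `k`, `|ω| ≤ B`).
* §2 `weightedProfile_comb_slotInv_level` — road-P2 g39 §3 at level `k` (any root offset, signs `s t s′ t′`, (INV-G) ∕ (INV-Z) DISPLAYED).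
* §3 centred root `toSite (ctrOff (d+1) Lc)`, `Lc` odd, weights `ω(x,z) = (if x_{κ₀} % Lc = Lc−1 then p₁ else 0)·(if z_{κ₀′} % Lc = Lc−1 then p₂ else 0)`:
  `tsum_exitWt_spureRecAt_slotInv_ctr_level` (`hZS` at EVERY level, `t = −1`), **`weightedProfile_comb_slotInv_ctr_exit_level`** (the profile identity
  `V^{base}(ν, 2•y − e_ν − y′) = −V^{end}(ν, y′)`, NO displayed hypothesis), **`weightedCharge_rotatedVertex_slotInv_ctr_exit_level`** and
  **`tsum_weightedCharge_rotatedVertex_slotInv_ctr_exit_level`** (the literal `hgeo` of road-P2's `tsum_slotMoment_pair_eq_zero`, `ε = −1`, EVERY level `k ≥ 0`).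
WHAT THIS FILE DOES NOT DO.  Nothing of (W-γ) ∕ (M0) ∕ the (S) assembly (sequel `SigmaPairSlotMomentsExit`); off-centre roots not claimed; asserts NO value of Bałaban's
tables; NEVER «G-an2-4 closed» as (CONV-C); NOT D1, NOT `BetaPertH`, NOT continuum, NOT Clay.  2026-08-22; no existing file touched.
-/

noncomputable section

open Finset
open scoped BigOperators
open Literature.MathematicalPhysics.QuantumFieldTheory
open Literature.MathematicalPhysics.QuantumFieldTheory.Balaban1983to89
open Literature.MathematicalPhysics.QuantumFieldTheory.Balaban1983to89.Beta
open ExpKernelCalculus (Site MKer)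
open AffineAveraging (box toSite unitVec)
open AveragingContours (blk)
open AveragingContoursRooted (ctrOff ctrOff_mem_box)
open OneStepResolventKernel (Fib)
open OneStepKernelFamily (KInvStep colH abs_colH_le)
open SecondOrderResponse (colM dM abs_colM_le)
open Summit.QuantumFields.BalabanUV.Beta.BorderedHessian (diagK)
open Summit.QuantumFields.BalabanUV.Beta.ChartConjugation (conjV)
open Summit.QuantumFields.BalabanUV.Beta.AveragingWardRootedStencils (legInd)
open Summit.QuantumFields.BalabanUV.Beta.AxialDressingRooted (coDressKBmAt decays_coDressKBmAt_KInvStep)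
open Summit.QuantumFields.BalabanUV.Beta.SpineRooted (SpureRecAt M1At locStencil_SpureRecAt vertexFamily_M1At)
open Summit.QuantumFields.BalabanUV.Beta.WardLocusResidualClass (abs_blockGen_le)
open Summit.QuantumFields.BalabanUV.Beta.GAN24.WardResidualLabelSums (decays_conjV_diagK)
open Summit.QuantumFields.BalabanUV.Beta.GAN24.WardResidualRotatedVertex (colH_conjV_diagK colM_conjV_diagK blockGen_inl blockGen_zsmul_inr)
open Summit.QuantumFields.BalabanUV.Beta.GAN24.WardResidualRotatedVertexWeighted (hasSum_weighted_dM)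
open Summit.QuantumFields.BalabanUV.Beta.GAN24.WardResidualRotatedVertexInversion (slotInv_eq_iff blk_pointInv_eq_iff blockGenEnd_zsmul_inr)
open Summit.QuantumFields.BalabanUV.Beta.GAN24.CoDressedColumnPointInversion (colH_pointInv_ctr colM_pointInv_ctr)
open Summit.QuantumFields.BalabanUV.Beta.GAN24.ConstraintHessianPointInversion (tsum_spanExitWt_M1At_slotInv_ctr)
open Summit.QuantumFields.BalabanUV.Beta.GAN24.ExitChargeParityTower (exitCharge_spureRecAt_pointInv_exit)

namespace Summit.QuantumFields.BalabanUV.Beta.GAN24.RotatedVertexSlotInversionAllLevels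

variable {d : ℕ} {Lc : ℕ} [NeZero Lc]

/-! ## §1 The ω-charges of `(α)` and `(α⁺)` per slot at EVERY level `k` (road-P2 g38 §3 ∕ g39 §4, token `j + 1 ↦ k`) -/

/-- NOT IN PRINT; OUR BOOKKEEPING.  **THE ω-CHARGE OF `(α)_y` AT LEVEL `k`** (any in-block root `ρ = toSite r`, any `k ≥ 0`, slot `(ν, y′)`, channel `(a,b)`, `|ω| ≤ B`):
the ω-charge of `½ • dM (conjV G_k X_y) Lc S_k M_k ν y′` HAS THE SUM given by the BASE-POINT profile
`½·[Σ_κ Σ'_u colH G_k ν y′ κ u·(½𝟙[y′ = y] − ½𝟙[blk u = y])·Z_S(κ,u) + Σ_ρ′ Σ'_w colM G_k ν y′ ρ′ w·(½𝟙[y′ = y] − ½𝟙[w = y])·Z_M(ρ′,w)]`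
— road-P2 g38 `hasSum_weighted_rotatedVertex_comb` is the member `k = j + 1` VERBATIM (same proof: an2's `hasSum_weighted_dM` on `conjV G_k X_y`). -/
theorem hasSum_weighted_rotatedVertex_comb_level (hLc : 1 ≤ Lc) {r : Fin (d + 1) → ℕ} (hr : r ∈ box (d + 1) Lc) (cE cVH cΛ : ℝ) (k : ℕ)
    (y : Site (d + 1)) (ν : Fin (d + 1)) (y' : Site (d + 1)) (a b : Fib d) {ω : Site (d + 1) × Site (d + 1) → ℝ} {B : ℝ} (hω : ∀ xz, |ω xz| ≤ B) :
    HasSum (fun xz : Site (d + 1) × Site (d + 1) => ω xz *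
        ((1 / 2 : ℝ) • dM (conjV (coDressKBmAt (toSite r) Lc (KInvStep (d := d) Lc k))
            (diagK (((1 : ℝ) / 2) • ∑ v ∈ box (d + 1) Lc, legInd (toSite r) ((Lc : ℤ) • y + toSite v)))) Lc
          (SpureRecAt d Lc (toSite r) cE cVH cΛ k) (M1At d Lc (toSite r) cΛ k) ν y') xz.1 xz.2 a b)
      ((1 / 2 : ℝ) *
        ((∑ κ : Fin (d + 1), ∑' u : Site (d + 1),
            colH (coDressKBmAt (toSite r) Lc (KInvStep (d := d) Lc k)) Lc ν y' κ u
              * ((if y' = y then (1 / 2 : ℝ) else 0) - (if blk Lc u = y then (1 / 2 : ℝ) else 0))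
              * ∑' xz : Site (d + 1) × Site (d + 1), ω xz * SpureRecAt d Lc (toSite r) cE cVH cΛ k κ u xz.1 xz.2 a b)
          + ∑ ρ' : Fin (d + 1), ∑' w : Site (d + 1),
            colM (coDressKBmAt (toSite r) Lc (KInvStep (d := d) Lc k)) Lc ν y' ρ' w
              * ((if y' = y then (1 / 2 : ℝ) else 0) - (if w = y then (1 / 2 : ℝ) else 0))
              * ∑' xz : Site (d + 1) × Site (d + 1), ω xz * M1At d Lc (toSite r) cΛ k ρ' w xz.1 xz.2 a b)) := by
  obtain ⟨δG, CG, hδG, hCG, hG⟩ := decays_coDressKBmAt_KInvStep (d := d) hr k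
  have hg : ∀ p c, |(((1 : ℝ) / 2) • ∑ v ∈ box (d + 1) Lc, legInd (toSite r) ((Lc : ℤ) • y + toSite v)) p c| ≤
      |((1 : ℝ) / 2)| * (box (d + 1) Lc).card := fun p c => abs_blockGen_le Lc (toSite r) _ y p c
  have hK := decays_conjV_diagK hG hg
  obtain ⟨Cs, δs, hδs, hS⟩ := locStencil_SpureRecAt (d := d) (Lc := Lc) hLc hr cE cVH cΛ k
  have hM := vertexFamily_M1At (d := d) hLc hr cΛ k (zero_le_one)
  have h := (hasSum_weighted_dM (c₀ := (Lc : ℤ) • y') (c₁ := (Lc : ℤ) • y') ν y' (fun κ t => abs_colH_le (N := Lc) hK ν y' κ t)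
    (fun ρ w => abs_colM_le (N := Lc) hK ν y' ρ w) hδG hS hδs hM one_pos a b hω).mul_left (1 / 2 : ℝ)
  simp only [colH_conjV_diagK, colM_conjV_diagK, blockGen_inl hLc, blockGen_zsmul_inr hr] at h
  refine h.congr_fun fun xz => ?_
  simp only [Pi.smul_apply, smul_eq_mul]
  ring

/-- NOT IN PRINT; OUR BOOKKEEPING.  **THE ω-CHARGE OF THE END-POINT ROTATED VERTEX `(α⁺)_y` AT LEVEL `k`** (same data; the end-point generator `X⁺_y = diagK g⁺`,
`g⁺(z,c) = g(z + step c, c)`): its sum is the END-POINT profile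
`½·[Σ_κ Σ'_u colH G_k ν y′ κ u·(½𝟙[y′ + e_ν = y] − ½𝟙[blk (u + e_κ) = y])·Z_S(κ,u) + Σ_ρ′ Σ'_w colM G_k ν y′ ρ′ w·(½𝟙[y′ + e_ν = y] − ½𝟙[w + e_ρ′ = y])·Z_M(ρ′,w)]`
— road-P2 g39 `hasSum_weighted_rotatedVertexEnd_comb` is the member `k = j + 1` VERBATIM. -/
theorem hasSum_weighted_rotatedVertexEnd_comb_level (hLc : 1 ≤ Lc) {r : Fin (d + 1) → ℕ} (hr : r ∈ box (d + 1) Lc) (cE cVH cΛ : ℝ) (k : ℕ)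
    (y : Site (d + 1)) (ν : Fin (d + 1)) (y' : Site (d + 1)) (a b : Fib d) {ω : Site (d + 1) × Site (d + 1) → ℝ} {B : ℝ} (hω : ∀ xz, |ω xz| ≤ B) :
    HasSum (fun xz : Site (d + 1) × Site (d + 1) => ω xz *
        ((1 / 2 : ℝ) • dM (conjV (coDressKBmAt (toSite r) Lc (KInvStep (d := d) Lc k)) (diagK (fun z c =>
            (((1 : ℝ) / 2) • ∑ v ∈ box (d + 1) Lc, legInd (toSite r) ((Lc : ℤ) • y + toSite v))
              (z + Sum.elim (fun κ => (Pi.single κ 1 : Site (d + 1))) (fun μ => (Lc : ℤ) • (Pi.single μ 1 : Site (d + 1))) c) c))) Lc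
          (SpureRecAt d Lc (toSite r) cE cVH cΛ k) (M1At d Lc (toSite r) cΛ k) ν y') xz.1 xz.2 a b)
      ((1 / 2 : ℝ) *
        ((∑ κ : Fin (d + 1), ∑' u : Site (d + 1),
            colH (coDressKBmAt (toSite r) Lc (KInvStep (d := d) Lc k)) Lc ν y' κ u
              * ((if y' + Pi.single ν 1 = y then (1 / 2 : ℝ) else 0) - (if blk Lc (u + Pi.single κ 1) = y then (1 / 2 : ℝ) else 0))
              * ∑' xz : Site (d + 1) × Site (d + 1), ω xz * SpureRecAt d Lc (toSite r) cE cVH cΛ k κ u xz.1 xz.2 a b)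
          + ∑ ρ' : Fin (d + 1), ∑' w : Site (d + 1),
            colM (coDressKBmAt (toSite r) Lc (KInvStep (d := d) Lc k)) Lc ν y' ρ' w
              * ((if y' + Pi.single ν 1 = y then (1 / 2 : ℝ) else 0) - (if w + Pi.single ρ' 1 = y then (1 / 2 : ℝ) else 0))
              * ∑' xz : Site (d + 1) × Site (d + 1), ω xz * M1At d Lc (toSite r) cΛ k ρ' w xz.1 xz.2 a b)) := by
  obtain ⟨δG, CG, hδG, hCG, hG⟩ := decays_coDressKBmAt_KInvStep (d := d) hr k
  have hg : ∀ p c, |(fun z c => (((1 : ℝ) / 2) • ∑ v ∈ box (d + 1) Lc, legInd (toSite r) ((Lc : ℤ) • y + toSite v))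
      (z + Sum.elim (fun κ => (Pi.single κ 1 : Site (d + 1))) (fun μ => (Lc : ℤ) • (Pi.single μ 1 : Site (d + 1))) c) c) p c| ≤
      |((1 : ℝ) / 2)| * (box (d + 1) Lc).card := fun p c => abs_blockGen_le Lc (toSite r) _ y _ c
  have hK := decays_conjV_diagK hG hg
  obtain ⟨Cs, δs, hδs, hS⟩ := locStencil_SpureRecAt (d := d) (Lc := Lc) hLc hr cE cVH cΛ k
  have hM := vertexFamily_M1At (d := d) hLc hr cΛ k (zero_le_one)
  have h := (hasSum_weighted_dM (c₀ := (Lc : ℤ) • y') (c₁ := (Lc : ℤ) • y') ν y' (fun κ t => abs_colH_le (N := Lc) hK ν y' κ t)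
    (fun ρ w => abs_colM_le (N := Lc) hK ν y' ρ w) hδG hS hδs hM one_pos a b hω).mul_left (1 / 2 : ℝ)
  simp only [colH_conjV_diagK, colM_conjV_diagK, Sum.elim_inl, Sum.elim_inr, blockGen_inl hLc, blockGenEnd_zsmul_inr hr] at h
  refine h.congr_fun fun xz => ?_
  simp only [Pi.smul_apply, smul_eq_mul]
  ring

/-! ## §2 Road-P2 g39 §3 at level `k`: the (α) profile at the inverted slot is `ε` times the END-POINT profile, given (INV-G) and (INV-Z) -/

/-- NOT IN PRINT; OUR BOOKKEEPING.  **(INV-X), STRUCTURAL HALF, AT LEVEL `k`** — road-P2 g39 `WardResidualRotatedVertexInversion.weightedProfile_comb_slotInv` with the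
level token `j + 1 ↦ k` (its `k = j + 1` member is that theorem VERBATIM; pure `tsum` re-indexing by the fine point inversion `u ↦ c_y − e_κ − u`,
`c_y = Lc•(2•y) + (Lc−1)•𝟙`, and the coarse one `w ↦ 2•y − e_ρ − w`; (INV-G) «`hGH`, `hGM`» and (INV-Z) «`hZS`, `hZM`» DISPLAYED with signs `s·t = ε = s′·t′`). -/
theorem weightedProfile_comb_slotInv_level (hLc : 1 ≤ Lc) (ρc : Site (d + 1)) (cE cVH cΛ : ℝ) (k : ℕ) (y : Site (d + 1)) (ν : Fin (d + 1)) (a b : Fib d)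
    (ω ω' : Site (d + 1) × Site (d + 1) → ℝ) (s t s' t' : Fin (d + 1) → ℝ) (ε : ℝ) (hst : ∀ κ, s κ * t κ = ε) (hst' : ∀ ρ, s' ρ * t' ρ = ε)
    (hGH : ∀ (y' : Site (d + 1)) (κ : Fin (d + 1)) (u : Site (d + 1)),
      colH (coDressKBmAt ρc Lc (KInvStep (d := d) Lc k)) Lc ν ((2 : ℕ) • y - Pi.single ν 1 - y') κ
          ((Lc : ℤ) • ((2 : ℕ) • y) + toSite (fun _ : Fin (d + 1) => Lc - 1) - Pi.single κ 1 - u)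
        = s κ * colH (coDressKBmAt ρc Lc (KInvStep (d := d) Lc k)) Lc ν y' κ u)
    (hGM : ∀ (y' : Site (d + 1)) (ρ : Fin (d + 1)) (w : Site (d + 1)),
      colM (coDressKBmAt ρc Lc (KInvStep (d := d) Lc k)) Lc ν ((2 : ℕ) • y - Pi.single ν 1 - y') ρ ((2 : ℕ) • y - Pi.single ρ 1 - w)
        = s' ρ * colM (coDressKBmAt ρc Lc (KInvStep (d := d) Lc k)) Lc ν y' ρ w)
    (hZS : ∀ (κ : Fin (d + 1)) (u : Site (d + 1)),
      ∑' xz : Site (d + 1) × Site (d + 1), ω xz * SpureRecAt d Lc ρc cE cVH cΛ k κ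
          ((Lc : ℤ) • ((2 : ℕ) • y) + toSite (fun _ : Fin (d + 1) => Lc - 1) - Pi.single κ 1 - u) xz.1 xz.2 a b
        = t κ * ∑' xz : Site (d + 1) × Site (d + 1), ω' xz * SpureRecAt d Lc ρc cE cVH cΛ k κ u xz.1 xz.2 a b)
    (hZM : ∀ (ρ : Fin (d + 1)) (w : Site (d + 1)),
      ∑' xz : Site (d + 1) × Site (d + 1), ω xz * M1At d Lc ρc cΛ k ρ ((2 : ℕ) • y - Pi.single ρ 1 - w) xz.1 xz.2 a b
        = t' ρ * ∑' xz : Site (d + 1) × Site (d + 1), ω' xz * M1At d Lc ρc cΛ k ρ w xz.1 xz.2 a b)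
    (y' : Site (d + 1)) :
    (1 / 2 : ℝ) *
        ((∑ κ : Fin (d + 1), ∑' u : Site (d + 1),
            colH (coDressKBmAt ρc Lc (KInvStep (d := d) Lc k)) Lc ν ((2 : ℕ) • y - Pi.single ν 1 - y') κ u
              * ((if (2 : ℕ) • y - Pi.single ν 1 - y' = y then (1 / 2 : ℝ) else 0) - (if blk Lc u = y then (1 / 2 : ℝ) else 0))
              * ∑' xz : Site (d + 1) × Site (d + 1), ω xz * SpureRecAt d Lc ρc cE cVH cΛ k κ u xz.1 xz.2 a b)
          + ∑ ρ' : Fin (d + 1), ∑' w : Site (d + 1),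
            colM (coDressKBmAt ρc Lc (KInvStep (d := d) Lc k)) Lc ν ((2 : ℕ) • y - Pi.single ν 1 - y') ρ' w
              * ((if (2 : ℕ) • y - Pi.single ν 1 - y' = y then (1 / 2 : ℝ) else 0) - (if w = y then (1 / 2 : ℝ) else 0))
              * ∑' xz : Site (d + 1) × Site (d + 1), ω xz * M1At d Lc ρc cΛ k ρ' w xz.1 xz.2 a b)
      = ε * ((1 / 2 : ℝ) *
        ((∑ κ : Fin (d + 1), ∑' u : Site (d + 1),
            colH (coDressKBmAt ρc Lc (KInvStep (d := d) Lc k)) Lc ν y' κ u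
              * ((if y' + Pi.single ν 1 = y then (1 / 2 : ℝ) else 0) - (if blk Lc (u + Pi.single κ 1) = y then (1 / 2 : ℝ) else 0))
              * ∑' xz : Site (d + 1) × Site (d + 1), ω' xz * SpureRecAt d Lc ρc cE cVH cΛ k κ u xz.1 xz.2 a b)
          + ∑ ρ' : Fin (d + 1), ∑' w : Site (d + 1),
            colM (coDressKBmAt ρc Lc (KInvStep (d := d) Lc k)) Lc ν y' ρ' w
              * ((if y' + Pi.single ν 1 = y then (1 / 2 : ℝ) else 0) - (if w + Pi.single ρ' 1 = y then (1 / 2 : ℝ) else 0))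
              * ∑' xz : Site (d + 1) × Site (d + 1), ω' xz * M1At d Lc ρc cΛ k ρ' w xz.1 xz.2 a b)) := by
  -- the two condition rewrites (slot and leg) of road-P2 g39 §2
  have eS : ∀ y₁ : Site (d + 1), ((2 : ℕ) • y - Pi.single ν 1 - y₁ = y) = (y₁ + Pi.single ν 1 = y) := fun y₁ => propext (slotInv_eq_iff y y₁ ν)
  have eF : ∀ (κ : Fin (d + 1)) (u : Site (d + 1)),
      (blk Lc ((Lc : ℤ) • ((2 : ℕ) • y) + toSite (fun _ : Fin (d + 1) => Lc - 1) - Pi.single κ 1 - u) = y) = (blk Lc (u + Pi.single κ 1) = y) :=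
    fun κ u => propext (blk_pointInv_eq_iff hLc y u κ)
  have eM : ∀ (ρ : Fin (d + 1)) (w : Site (d + 1)), ((2 : ℕ) • y - Pi.single ρ 1 - w = y) = (w + Pi.single ρ 1 = y) := fun ρ w => propext (slotInv_eq_iff y w ρ)
  -- field half: re-index `u ↦ c_y − e_κ − u`
  have hF : ∀ κ : Fin (d + 1),
      ∑' u : Site (d + 1), colH (coDressKBmAt ρc Lc (KInvStep (d := d) Lc k)) Lc ν ((2 : ℕ) • y - Pi.single ν 1 - y') κ u
          * ((if (2 : ℕ) • y - Pi.single ν 1 - y' = y then (1 / 2 : ℝ) else 0) - (if blk Lc u = y then (1 / 2 : ℝ) else 0))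
          * ∑' xz : Site (d + 1) × Site (d + 1), ω xz * SpureRecAt d Lc ρc cE cVH cΛ k κ u xz.1 xz.2 a b
        = ε * ∑' u : Site (d + 1), colH (coDressKBmAt ρc Lc (KInvStep (d := d) Lc k)) Lc ν y' κ u
          * ((if y' + Pi.single ν 1 = y then (1 / 2 : ℝ) else 0) - (if blk Lc (u + Pi.single κ 1) = y then (1 / 2 : ℝ) else 0))
          * ∑' xz : Site (d + 1) × Site (d + 1), ω' xz * SpureRecAt d Lc ρc cE cVH cΛ k κ u xz.1 xz.2 a b := by
    intro κ
    let E : Site (d + 1) ≃ Site (d + 1) :=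
      Equiv.subLeft (((Lc : ℤ) • ((2 : ℕ) • y) + toSite (fun _ : Fin (d + 1) => Lc - 1) - Pi.single κ 1 : Site (d + 1)))
    rw [← tsum_mul_left]
    refine (E.tsum_eq _).symm.trans ?_
    refine tsum_congr fun u => ?_
    simp only [E, Equiv.subLeft_apply, eS, eF]
    rw [hGH, hZS]
    calc s κ * colH (coDressKBmAt ρc Lc (KInvStep (d := d) Lc k)) Lc ν y' κ u
          * ((if y' + Pi.single ν 1 = y then (1 / 2 : ℝ) else 0) - (if blk Lc (u + Pi.single κ 1) = y then (1 / 2 : ℝ) else 0))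
          * (t κ * ∑' xz : Site (d + 1) × Site (d + 1), ω' xz * SpureRecAt d Lc ρc cE cVH cΛ k κ u xz.1 xz.2 a b)
        = (s κ * t κ) * (colH (coDressKBmAt ρc Lc (KInvStep (d := d) Lc k)) Lc ν y' κ u
          * ((if y' + Pi.single ν 1 = y then (1 / 2 : ℝ) else 0) - (if blk Lc (u + Pi.single κ 1) = y then (1 / 2 : ℝ) else 0))
          * ∑' xz : Site (d + 1) × Site (d + 1), ω' xz * SpureRecAt d Lc ρc cE cVH cΛ k κ u xz.1 xz.2 a b) := by ring
      _ = _ := by rw [hst]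
  -- multiplier half: re-index `w ↦ 2•y − e_ρ − w`
  have hMp : ∀ ρ' : Fin (d + 1),
      ∑' w : Site (d + 1), colM (coDressKBmAt ρc Lc (KInvStep (d := d) Lc k)) Lc ν ((2 : ℕ) • y - Pi.single ν 1 - y') ρ' w
          * ((if (2 : ℕ) • y - Pi.single ν 1 - y' = y then (1 / 2 : ℝ) else 0) - (if w = y then (1 / 2 : ℝ) else 0))
          * ∑' xz : Site (d + 1) × Site (d + 1), ω xz * M1At d Lc ρc cΛ k ρ' w xz.1 xz.2 a b
        = ε * ∑' w : Site (d + 1), colM (coDressKBmAt ρc Lc (KInvStep (d := d) Lc k)) Lc ν y' ρ' w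
          * ((if y' + Pi.single ν 1 = y then (1 / 2 : ℝ) else 0) - (if w + Pi.single ρ' 1 = y then (1 / 2 : ℝ) else 0))
          * ∑' xz : Site (d + 1) × Site (d + 1), ω' xz * M1At d Lc ρc cΛ k ρ' w xz.1 xz.2 a b := by
    intro ρ'
    let E : Site (d + 1) ≃ Site (d + 1) := Equiv.subLeft (((2 : ℕ) • y - Pi.single ρ' (1 : ℤ) : Site (d + 1)))
    rw [← tsum_mul_left]
    refine (E.tsum_eq _).symm.trans ?_
    refine tsum_congr fun w => ?_
    simp only [E, Equiv.subLeft_apply, eS, eM]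
    rw [hGM, hZM]
    calc s' ρ' * colM (coDressKBmAt ρc Lc (KInvStep (d := d) Lc k)) Lc ν y' ρ' w
          * ((if y' + Pi.single ν 1 = y then (1 / 2 : ℝ) else 0) - (if w + Pi.single ρ' 1 = y then (1 / 2 : ℝ) else 0))
          * (t' ρ' * ∑' xz : Site (d + 1) × Site (d + 1), ω' xz * M1At d Lc ρc cΛ k ρ' w xz.1 xz.2 a b)
        = (s' ρ' * t' ρ') * (colM (coDressKBmAt ρc Lc (KInvStep (d := d) Lc k)) Lc ν y' ρ' w
          * ((if y' + Pi.single ν 1 = y then (1 / 2 : ℝ) else 0) - (if w + Pi.single ρ' 1 = y then (1 / 2 : ℝ) else 0))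
          * ∑' xz : Site (d + 1) × Site (d + 1), ω' xz * M1At d Lc ρc cΛ k ρ' w xz.1 xz.2 a b) := by ring
      _ = _ := by rw [hst']
  simp only [hF, hMp, ← Finset.mul_sum]
  ring

/-! ## §3 Centred root, `Lc` odd, the class `(p₁𝟙^{exit}_{κ₀}) ⊗ (p₂𝟙^{exit}_{κ₀′})`: (INV-G), `hZM`, `hZS` discharged at EVERY level -/

section Ctr

/-- NOT IN PRINT; OUR BOOKKEEPING.  **`hZS` AT EVERY LEVEL `k ≥ 0` FOR THE EXIT CLASS** (centred root, `Lc` odd, all `cE cVH cΛ`, label `y`, channel `(inl κ₀, inl κ₀′)`,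
coefficients `p₁ p₂`): with `ω(x,z) := (if x_{κ₀} % Lc = Lc−1 then p₁ else 0)·(if z_{κ₀′} % Lc = Lc−1 then p₂ else 0)`,
`Σ' ω·S_k κ (c_y − e_κ − u) x z (inl κ₀)(inl κ₀′) = (−1)·Σ' ω·S_k κ u x z (inl κ₀)(inl κ₀′)`, `c_y = Lc•(2•y) + (Lc−1)•𝟙` — gen 58's parity tower
`exitCharge_spureRecAt_pointInv_exit` (stated for every `j`, incl. `0`) at `t = 2•y`, with the coefficients factored out; gen 58's `tsum_exitWt_spureRecAt_slotInv_ctr` is the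
member `k = j + 1`. -/
theorem tsum_exitWt_spureRecAt_slotInv_ctr_level (hLc : Odd Lc) (cE cVH cΛ : ℝ) (k : ℕ) (y : Site (d + 1)) (κ₀ κ₀' : Fin (d + 1)) (p₁ p₂ : ℝ)
    (κ : Fin (d + 1)) (u : Site (d + 1)) :
    ∑' xz : Site (d + 1) × Site (d + 1),
        ((if xz.1 κ₀ % (Lc : ℤ) = (Lc : ℤ) - 1 then p₁ else 0) * (if xz.2 κ₀' % (Lc : ℤ) = (Lc : ℤ) - 1 then p₂ else 0))
          * SpureRecAt d Lc (toSite (ctrOff (d + 1) Lc)) cE cVH cΛ k κ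
            ((Lc : ℤ) • ((2 : ℕ) • y) + toSite (fun _ : Fin (d + 1) => Lc - 1) - Pi.single κ 1 - u) xz.1 xz.2 (Sum.inl κ₀) (Sum.inl κ₀')
      = (-1) * ∑' xz : Site (d + 1) × Site (d + 1),
        ((if xz.1 κ₀ % (Lc : ℤ) = (Lc : ℤ) - 1 then p₁ else 0) * (if xz.2 κ₀' % (Lc : ℤ) = (Lc : ℤ) - 1 then p₂ else 0))
          * SpureRecAt d Lc (toSite (ctrOff (d + 1) Lc)) cE cVH cΛ k κ u xz.1 xz.2 (Sum.inl κ₀) (Sum.inl κ₀') := by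
  have hLc1 : 1 ≤ Lc := hLc.pos
  -- the coefficients factor out of the indicators
  have ew : ∀ xz : Site (d + 1) × Site (d + 1),
      (if xz.1 κ₀ % (Lc : ℤ) = (Lc : ℤ) - 1 then p₁ else 0) * (if xz.2 κ₀' % (Lc : ℤ) = (Lc : ℤ) - 1 then p₂ else 0)
        = (p₁ * p₂) * ((if xz.1 κ₀ % (Lc : ℤ) = (Lc : ℤ) - 1 then (1 : ℝ) else 0) * (if xz.2 κ₀' % (Lc : ℤ) = (Lc : ℤ) - 1 then (1 : ℝ) else 0)) := fun xz => by
    split_ifs <;> ring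
  have ec : ((Lc : ℤ) • ((2 : ℕ) • y) + toSite (fun _ : Fin (d + 1) => Lc - 1) - Pi.single κ 1 - u : Site (d + 1))
      = (Lc : ℤ) • ((2 : ℕ) • y) + (fun _ : Fin (d + 1) => (Lc : ℤ) - 1) - unitVec κ - u := by
    funext i
    simp only [Pi.add_apply, Pi.sub_apply, Pi.smul_apply, smul_eq_mul, toSite, Nat.cast_sub hLc1, Nat.cast_one, AffineAveraging.unitVec]
  simp only [ew, mul_assoc, tsum_mul_left]
  rw [ec]
  have h := exitCharge_spureRecAt_pointInv_exit hLc cE cVH cΛ κ₀ κ₀' k ((2 : ℕ) • y) κ u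
  simp only [mul_assoc] at h
  rw [h]
  ring

/-- NOT IN PRINT; OUR BOOKKEEPING.  **(INV-X-geo) AT EVERY LEVEL `k ≥ 0`, PROFILE FORM, NO DISPLAYED HYPOTHESIS** (centred root, `Lc` odd, all `cE cVH cΛ`, label `y`, slot
direction `ν`, channel `(inl κ₀, inl κ₀′)`, coefficients `p₁ p₂`): with the exit weights of §3 and `G_k = coDressKBmAt ρ_ctr Lc (KInvStep Lc k)`, `S_k`, `M_k`:
`V^{base}_k(ν, 2•y − e_ν − y′) = −V^{end}_k(ν, y′)` — §2 with (INV-G) from gen 58's `colH_pointInv_ctr ∕ colM_pointInv_ctr` (`s = s′ = 1`), `hZM` from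
`tsum_spanExitWt_M1At_slotInv_ctr` and `hZS` from `tsum_exitWt_spureRecAt_slotInv_ctr_level` (`t = t′ = −1`).  The `k = 0` member is the (α)-side input of the (S) row at
the level where leaf-06's FILE F supplies (W-γ). -/
theorem weightedProfile_comb_slotInv_ctr_exit_level (hLc : Odd Lc) (cE cVH cΛ : ℝ) (k : ℕ) (y : Site (d + 1)) (ν κ₀ κ₀' : Fin (d + 1)) (p₁ p₂ : ℝ)
    (y' : Site (d + 1)) :
    (1 / 2 : ℝ) *
        ((∑ κ : Fin (d + 1), ∑' u : Site (d + 1),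
            colH (coDressKBmAt (toSite (ctrOff (d + 1) Lc)) Lc (KInvStep (d := d) Lc k)) Lc ν ((2 : ℕ) • y - Pi.single ν 1 - y') κ u
              * ((if (2 : ℕ) • y - Pi.single ν 1 - y' = y then (1 / 2 : ℝ) else 0) - (if blk Lc u = y then (1 / 2 : ℝ) else 0))
              * ∑' xz : Site (d + 1) × Site (d + 1),
                  ((if xz.1 κ₀ % (Lc : ℤ) = (Lc : ℤ) - 1 then p₁ else 0) * (if xz.2 κ₀' % (Lc : ℤ) = (Lc : ℤ) - 1 then p₂ else 0))
                    * SpureRecAt d Lc (toSite (ctrOff (d + 1) Lc)) cE cVH cΛ k κ u xz.1 xz.2 (Sum.inl κ₀) (Sum.inl κ₀'))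
          + ∑ ρ' : Fin (d + 1), ∑' w : Site (d + 1),
            colM (coDressKBmAt (toSite (ctrOff (d + 1) Lc)) Lc (KInvStep (d := d) Lc k)) Lc ν ((2 : ℕ) • y - Pi.single ν 1 - y') ρ' w
              * ((if (2 : ℕ) • y - Pi.single ν 1 - y' = y then (1 / 2 : ℝ) else 0) - (if w = y then (1 / 2 : ℝ) else 0))
              * ∑' xz : Site (d + 1) × Site (d + 1),
                  ((if xz.1 κ₀ % (Lc : ℤ) = (Lc : ℤ) - 1 then p₁ else 0) * (if xz.2 κ₀' % (Lc : ℤ) = (Lc : ℤ) - 1 then p₂ else 0))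
                    * M1At d Lc (toSite (ctrOff (d + 1) Lc)) cΛ k ρ' w xz.1 xz.2 (Sum.inl κ₀) (Sum.inl κ₀'))
      = (-1) * ((1 / 2 : ℝ) *
        ((∑ κ : Fin (d + 1), ∑' u : Site (d + 1),
            colH (coDressKBmAt (toSite (ctrOff (d + 1) Lc)) Lc (KInvStep (d := d) Lc k)) Lc ν y' κ u
              * ((if y' + Pi.single ν 1 = y then (1 / 2 : ℝ) else 0) - (if blk Lc (u + Pi.single κ 1) = y then (1 / 2 : ℝ) else 0))
              * ∑' xz : Site (d + 1) × Site (d + 1),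
                  ((if xz.1 κ₀ % (Lc : ℤ) = (Lc : ℤ) - 1 then p₁ else 0) * (if xz.2 κ₀' % (Lc : ℤ) = (Lc : ℤ) - 1 then p₂ else 0))
                    * SpureRecAt d Lc (toSite (ctrOff (d + 1) Lc)) cE cVH cΛ k κ u xz.1 xz.2 (Sum.inl κ₀) (Sum.inl κ₀'))
          + ∑ ρ' : Fin (d + 1), ∑' w : Site (d + 1),
            colM (coDressKBmAt (toSite (ctrOff (d + 1) Lc)) Lc (KInvStep (d := d) Lc k)) Lc ν y' ρ' w
              * ((if y' + Pi.single ν 1 = y then (1 / 2 : ℝ) else 0) - (if w + Pi.single ρ' 1 = y then (1 / 2 : ℝ) else 0))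
              * ∑' xz : Site (d + 1) × Site (d + 1),
                  ((if xz.1 κ₀ % (Lc : ℤ) = (Lc : ℤ) - 1 then p₁ else 0) * (if xz.2 κ₀' % (Lc : ℤ) = (Lc : ℤ) - 1 then p₂ else 0))
                    * M1At d Lc (toSite (ctrOff (d + 1) Lc)) cΛ k ρ' w xz.1 xz.2 (Sum.inl κ₀) (Sum.inl κ₀'))) :=
  weightedProfile_comb_slotInv_level hLc.pos (toSite (ctrOff (d + 1) Lc)) cE cVH cΛ k y ν (Sum.inl κ₀) (Sum.inl κ₀')
    (fun xz => (if xz.1 κ₀ % (Lc : ℤ) = (Lc : ℤ) - 1 then p₁ else 0) * (if xz.2 κ₀' % (Lc : ℤ) = (Lc : ℤ) - 1 then p₂ else 0))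
    (fun xz => (if xz.1 κ₀ % (Lc : ℤ) = (Lc : ℤ) - 1 then p₁ else 0) * (if xz.2 κ₀' % (Lc : ℤ) = (Lc : ℤ) - 1 then p₂ else 0))
    (fun _ => 1) (fun _ => -1) (fun _ => 1) (fun _ => -1) (-1) (fun _ => one_mul (-1 : ℝ)) (fun _ => one_mul (-1 : ℝ))
    (fun y' κ u => by rw [one_mul]; exact colH_pointInv_ctr hLc k y ν y' κ u)
    (fun y' ρ w => by rw [one_mul]; exact colM_pointInv_ctr hLc k y ν y' ρ w)
    (fun κ u => tsum_exitWt_spureRecAt_slotInv_ctr_level hLc cE cVH cΛ k y κ₀ κ₀' p₁ p₂ κ u)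
    (fun ρ' w => tsum_spanExitWt_M1At_slotInv_ctr hLc cΛ k y κ₀ κ₀' p₁ 0 p₂ 0 ρ' w) y'

omit [NeZero Lc] in
/-- [folklore] The exit weights are bounded: `|ω(x,z)| ≤ |p₁|·|p₂|`. -/
theorem abs_exitWt_le (κ₀ κ₀' : Fin (d + 1)) (p₁ p₂ : ℝ) (xz : Site (d + 1) × Site (d + 1)) :
    |(if xz.1 κ₀ % (Lc : ℤ) = (Lc : ℤ) - 1 then p₁ else 0) * (if xz.2 κ₀' % (Lc : ℤ) = (Lc : ℤ) - 1 then p₂ else 0)| ≤ |p₁| * |p₂| := by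
  rw [abs_mul]
  refine mul_le_mul ?_ ?_ (abs_nonneg _) (abs_nonneg _)
  · split_ifs
    · exact le_rfl
    · rw [abs_zero]; exact abs_nonneg _
  · split_ifs
    · exact le_rfl
    · rw [abs_zero]; exact abs_nonneg _

/-- NOT IN PRINT; OUR BOOKKEEPING.  **(INV-X-geo) AT EVERY LEVEL `k ≥ 0`, CHARGE FORM, NO DISPLAYED HYPOTHESIS** (centred root, `Lc` odd, all `cE cVH cΛ`, label `y`, slot direction
`ν`, channel `(inl κ₀, inl κ₀′)`, coefficients `p₁ p₂`): if the ω-charge of the END-POINT rotated vertex `(α⁺)_y` (level `k`) at the slot `(ν, y′)` is `v`, then the ω-charge of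
`(α)_y = ½ • dM (conjV G_k X_y) Lc S_k M_k` at the inverted slot `(ν, 2•y − e_ν − y′)` is `−v` (§1 ⨾ §3's profile identity; gen 58's `weightedCharge_rotatedVertex_slotInv_ctr_exit`
is the member `k = j + 1`). -/
theorem weightedCharge_rotatedVertex_slotInv_ctr_exit_level (hLc : Odd Lc) (cE cVH cΛ : ℝ) (k : ℕ) (y : Site (d + 1)) (ν κ₀ κ₀' : Fin (d + 1)) (p₁ p₂ : ℝ)
    (y' : Site (d + 1)) {v : ℝ}
    (hv : HasSum (fun xz : Site (d + 1) × Site (d + 1) =>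
        ((if xz.1 κ₀ % (Lc : ℤ) = (Lc : ℤ) - 1 then p₁ else 0) * (if xz.2 κ₀' % (Lc : ℤ) = (Lc : ℤ) - 1 then p₂ else 0)) *
        ((1 / 2 : ℝ) • dM (conjV (coDressKBmAt (toSite (ctrOff (d + 1) Lc)) Lc (KInvStep (d := d) Lc k)) (diagK (fun z c =>
            (((1 : ℝ) / 2) • ∑ v ∈ box (d + 1) Lc, legInd (toSite (ctrOff (d + 1) Lc)) ((Lc : ℤ) • y + toSite v))
              (z + Sum.elim (fun κ => (Pi.single κ 1 : Site (d + 1))) (fun μ => (Lc : ℤ) • (Pi.single μ 1 : Site (d + 1))) c) c))) Lc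
          (SpureRecAt d Lc (toSite (ctrOff (d + 1) Lc)) cE cVH cΛ k) (M1At d Lc (toSite (ctrOff (d + 1) Lc)) cΛ k) ν y') xz.1 xz.2
          (Sum.inl κ₀) (Sum.inl κ₀')) v) :
    HasSum (fun xz : Site (d + 1) × Site (d + 1) =>
        ((if xz.1 κ₀ % (Lc : ℤ) = (Lc : ℤ) - 1 then p₁ else 0) * (if xz.2 κ₀' % (Lc : ℤ) = (Lc : ℤ) - 1 then p₂ else 0)) *
        ((1 / 2 : ℝ) • dM (conjV (coDressKBmAt (toSite (ctrOff (d + 1) Lc)) Lc (KInvStep (d := d) Lc k))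
            (diagK (((1 : ℝ) / 2) • ∑ v ∈ box (d + 1) Lc, legInd (toSite (ctrOff (d + 1) Lc)) ((Lc : ℤ) • y + toSite v)))) Lc
          (SpureRecAt d Lc (toSite (ctrOff (d + 1) Lc)) cE cVH cΛ k) (M1At d Lc (toSite (ctrOff (d + 1) Lc)) cΛ k) ν
          ((2 : ℕ) • y - Pi.single ν 1 - y')) xz.1 xz.2 (Sum.inl κ₀) (Sum.inl κ₀'))
      ((-1) * v) := by
  have hω := abs_exitWt_le (Lc := Lc) κ₀ κ₀' p₁ p₂
  have hend := hasSum_weighted_rotatedVertexEnd_comb_level hLc.pos (ctrOff_mem_box hLc.pos) cE cVH cΛ k y ν y' (Sum.inl κ₀) (Sum.inl κ₀') hω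
  rw [hv.unique hend]
  have h := hasSum_weighted_rotatedVertex_comb_level hLc.pos (ctrOff_mem_box hLc.pos) cE cVH cΛ k y ν ((2 : ℕ) • y - Pi.single ν 1 - y') (Sum.inl κ₀) (Sum.inl κ₀') hω
  rw [weightedProfile_comb_slotInv_ctr_exit_level hLc cE cVH cΛ k y ν κ₀ κ₀' p₁ p₂ y'] at h
  exact h

/-- NOT IN PRINT; OUR BOOKKEEPING.  **(INV-X-geo) AT EVERY LEVEL `k ≥ 0` AS THE PROFILE IDENTITY `hgeo` OF ROAD-P2's `tsum_slotMoment_pair_eq_zero`** (centred root, `Lc` odd, all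
`cE cVH cΛ`, label `y`, slot direction `ν`, channel `(inl κ₀, inl κ₀′)`, coefficients `p₁ p₂`; NO displayed hypothesis): in `tsum` form,
`Σ' ω·(α)_y-charge at (ν, 2•y − e_ν − y′) = (−1)·Σ' ω·(α⁺)_y-charge at (ν, y′)` — `Vα (2•y − e_ν − y′) = ε·V⁺ y′`, `ε = −1`, at EVERY level including the residual tower's base
`k = 0` (gen 58's `tsum_weightedCharge_rotatedVertex_slotInv_ctr_exit` is the member `k = j + 1`). -/
theorem tsum_weightedCharge_rotatedVertex_slotInv_ctr_exit_level (hLc : Odd Lc) (cE cVH cΛ : ℝ) (k : ℕ) (y : Site (d + 1)) (ν κ₀ κ₀' : Fin (d + 1)) (p₁ p₂ : ℝ)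
    (y' : Site (d + 1)) :
    ∑' xz : Site (d + 1) × Site (d + 1),
        ((if xz.1 κ₀ % (Lc : ℤ) = (Lc : ℤ) - 1 then p₁ else 0) * (if xz.2 κ₀' % (Lc : ℤ) = (Lc : ℤ) - 1 then p₂ else 0)) *
        ((1 / 2 : ℝ) • dM (conjV (coDressKBmAt (toSite (ctrOff (d + 1) Lc)) Lc (KInvStep (d := d) Lc k))
            (diagK (((1 : ℝ) / 2) • ∑ v ∈ box (d + 1) Lc, legInd (toSite (ctrOff (d + 1) Lc)) ((Lc : ℤ) • y + toSite v)))) Lc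
          (SpureRecAt d Lc (toSite (ctrOff (d + 1) Lc)) cE cVH cΛ k) (M1At d Lc (toSite (ctrOff (d + 1) Lc)) cΛ k) ν
          ((2 : ℕ) • y - Pi.single ν 1 - y')) xz.1 xz.2 (Sum.inl κ₀) (Sum.inl κ₀')
      = (-1) * ∑' xz : Site (d + 1) × Site (d + 1),
        ((if xz.1 κ₀ % (Lc : ℤ) = (Lc : ℤ) - 1 then p₁ else 0) * (if xz.2 κ₀' % (Lc : ℤ) = (Lc : ℤ) - 1 then p₂ else 0)) *
        ((1 / 2 : ℝ) • dM (conjV (coDressKBmAt (toSite (ctrOff (d + 1) Lc)) Lc (KInvStep (d := d) Lc k)) (diagK (fun z c =>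
            (((1 : ℝ) / 2) • ∑ v ∈ box (d + 1) Lc, legInd (toSite (ctrOff (d + 1) Lc)) ((Lc : ℤ) • y + toSite v))
              (z + Sum.elim (fun κ => (Pi.single κ 1 : Site (d + 1))) (fun μ => (Lc : ℤ) • (Pi.single μ 1 : Site (d + 1))) c) c))) Lc
          (SpureRecAt d Lc (toSite (ctrOff (d + 1) Lc)) cE cVH cΛ k) (M1At d Lc (toSite (ctrOff (d + 1) Lc)) cΛ k) ν y') xz.1 xz.2
          (Sum.inl κ₀) (Sum.inl κ₀') := by
  have hω := abs_exitWt_le (Lc := Lc) κ₀ κ₀' p₁ p₂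
  have hend := hasSum_weighted_rotatedVertexEnd_comb_level hLc.pos (ctrOff_mem_box hLc.pos) cE cVH cΛ k y ν y' (Sum.inl κ₀) (Sum.inl κ₀') hω
  rw [(weightedCharge_rotatedVertex_slotInv_ctr_exit_level hLc cE cVH cΛ k y ν κ₀ κ₀' p₁ p₂ y' hend).tsum_eq, hend.tsum_eq]

end Ctr

end Summit.QuantumFields.BalabanUV.Beta.GAN24.RotatedVertexSlotInversionAllLevels

end
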